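import Summits.QuantumFields.BalabanUV.Beta.FP.TorusTwoScaleSandwichPeriodic

/-!
# `BalabanUV.Beta.FP.TorusTwoScaleSandwichLetters` — road «FP» for binder row D1, ROUTE T (β1), J-RISK-3′ «THE PACKING AT THE PASS», beside the engine:
# **THE SANDWICH KERNEL INHERITS THE TWO PERIODISATION LETTERS FROM ITS CORE** (so that the storey kernels of `TorusCompanionSumPeriodic` can be summed)

WHY.  The engine `TorusTwoScaleSandwichPeriodic.transpose_mul_perF_dper_mul` (g36 p408072 ✓) packs one storey: `Cmᵀ * perF Tc (dper Tc 𝒢) * Cm = perF Tf (dper Tf 𝒦)`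
for the lattice sandwich `𝒦` of the core `𝒢` by an equivariant windowed two-scale leg `CL`.  The storey sum `TorusCompanionSumPeriodic.compSumSym_eq_perF_dper_sum`
(g36 p408619 ✓) then adds the storeys up as `perF Tf (dper Tf (Σ_j 𝒦_j))` — under the two pointwise summability letters OF EACH `𝒦_j` w.r.t. the finest torus
(`hSd`: diagonal `Tf`-translates; `hSp`: `Tf`-translates of `dper Tf 𝒦_j`).  THIS FILE derives those two letters of the SANDWICH from the same two letters of its CORE
(`hGd ∕ hGp` w.r.t. `Tc`), with the engine's data and in its vocabulary — plus the engine's (internal) first step as a named identity: the diagonal periodisation of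
the sandwich IS the sandwich of the diagonally periodised core.

WHAT ([folklore] finite-sum ∕ `tsum` bookkeeping over the engine's §1 lemmas; no `def`, no `def … : Prop`, nothing cited, 0 sorry):
* `sandwich_translate_diag` — `𝒦 (β+Tf∘m₀) (β′+Tf∘m₀) b b′ = Σ_{a a′} Σ_{γ ∈ S β} Σ_{γ′ ∈ S β′} CL γ a β b · 𝒢 (γ+Tc∘m₀) (γ′+Tc∘m₀) a a′ · CL γ′ a′ β′ b′`
  (`sum_window_sandwich_translate` per fibre pair; no letter);
* **`summable_sandwich_diag`** — the `hSd` letter of `𝒦` from `hGd`;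
* **`dper_sandwich_apply`** — `dper Tf 𝒦 β β′ b b′ = Σ_{a a′} Σ_{γ ∈ S β} Σ_{γ′ ∈ S β′} CL γ a β b · dper Tc 𝒢 γ γ′ a a′ · CL γ′ a′ β′ b′` (from `hGd`);
* `dper_sandwich_translate_right` — `dper Tf 𝒦 β (β′+Tf∘m) b b′ = Σ … CL γ a β b · dper Tc 𝒢 γ (γ′+Tc∘m) a a′ · CL γ′ a′ β′ b′` (`sum_window_right_translate`);
* **`summable_dper_sandwich_right`** — the `hSp` letter of `𝒦` from `hGd` + `hGp`;
* the WINDOW-FREE twins `summable_sandwich_diag_of_tsum` ∕ `summable_dper_sandwich_right_of_tsum` for a sandwich displayed with finitely supported `Σ'_γ Σ'_{γ′}`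
  (the spelling of `TorusCompositeRowsSymSandwich` p408501 ✓).
WHAT THIS IS NOT: no new identity of the packing, no row of the END wrapper discharged; no estimate; nothing of Bałaban's asserted, valued or discharged; 0∕4 row-D1
binders (hW, hR, D1Tel, D1Rep); NOT (C1), NOT (T-ID), NOT SDF, NOT D1, NOT BetaPertH, NOT continuum, NOT Clay.  «not in print; our bookkeeping».

HONEST DEPENDENCY (page 1, mandatory): continuum YM on T⁴ ⇐ BetaPertH ∧ nine spine estimates (0/9 proved); BetaPertH ⇐ (D1) ∧ (D4) ∧ CAP+tail;
G-an2-4 gates asym, D1 and NE2/3/4.  HONEST FRAMING (cell contract, verbatim): «discharging `BetaPertH` makes Bałaban's UV stability UNCONDITIONAL —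
a real constructive-QFT result; it is NOT the continuum limit and NOT the Clay problem.»  ABSOLUTE RULE (cell charter, verbatim): «No internally-minted
statement may enter as a cited fact. Every hypothesis is either kernel-proved in this package or a verbatim quotation of a PUBLISHED theorem with page
reference. The manuscript(s) under audit are NOT citable for their own disputed steps — they are the thing under adjudication; programme-internal
(2001/route/tribunal) claims are never citable.»  Road «FP» OWNER, b2b-balaban-beta-d1-p3 gen 36, 2026-08-25.  No existing file touched.
-/

noncomputable section

open scoped BigOperators

namespace Summit.QuantumFields.BalabanUV.Beta.FP.TorusTwoScaleSandwichLetters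

open Finset
open Literature.MathematicalPhysics.QuantumFieldTheory.Balaban1983to89
open Literature.MathematicalPhysics.QuantumFieldTheory.Balaban1983to89.Beta
open B4TorusKernel.MultiPeriod (translate)
open ExpKernelCalculus (MKer)
open Summit.QuantumFields.BalabanUV.Beta.FP.KernelPeriodisationFibLoc (dper dper_apply)
open Summit.QuantumFields.BalabanUV.Beta.FP.TorusTwoScaleSandwichPeriodic (sum_window_sandwich_translate sum_window_right_translate
  tsum_window_sandwich_of_summable)

variable {d : ℕ} (Tc Tf : Fin (d + 1) → ℕ) {A B : Type*} [Fintype A]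

/-! ## §1 The window display -/

section Window

variable (CL : (Fin (d + 1) → ℤ) → A → (Fin (d + 1) → ℤ) → B → ℝ)
  (hCL : ∀ m γ a β b, CL (translate Tc γ m) a (translate Tf β m) b = CL γ a β b)
  (S : (Fin (d + 1) → ℤ) → Finset (Fin (d + 1) → ℤ)) (hS : ∀ γ a β b, γ ∉ S β → CL γ a β b = 0)
  (𝒢 : MKer (d + 1) A) {𝒦 : MKer (d + 1) B}
  (h𝒦 : ∀ β β' b b', 𝒦 β β' b b' = ∑ a, ∑ a', ∑ γ ∈ S β, ∑ γ' ∈ S β', CL γ a β b * 𝒢 γ γ' a a' * CL γ' a' β' b')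
include hCL hS h𝒦

/-- [folklore] **THE SANDWICH ALONG A DIAGONAL `Tf`-TRANSLATE IS THE SANDWICH OF THE DIAGONALLY TRANSLATED CORE** (windows re-indexed, no letter). -/
theorem sandwich_translate_diag (m₀ β β' : Fin (d + 1) → ℤ) (b b' : B) :
    𝒦 (translate Tf β m₀) (translate Tf β' m₀) b b'
      = ∑ a, ∑ a', ∑ γ ∈ S β, ∑ γ' ∈ S β', CL γ a β b * 𝒢 (translate Tc γ m₀) (translate Tc γ' m₀) a a' * CL γ' a' β' b' := by
  rw [h𝒦]
  exact Finset.sum_congr rfl fun a _ => Finset.sum_congr rfl fun a' _ =>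
    sum_window_sandwich_translate Tc Tf (fun γ β => CL γ a β b) (fun γ β => CL γ a' β b') (fun m γ β => hCL m γ a β b)
      (fun m γ β => hCL m γ a' β b') S S (fun γ β h => hS γ a β b h) (fun γ β h => hS γ a' β b' h) (fun γ γ' => 𝒢 γ γ' a a') m₀ β β'

/-- [folklore] **`summable_sandwich_diag` — THE `hSd` LETTER OF THE SANDWICH FROM THE CORE's `hGd`**: the diagonal `Tf`-translates of `𝒦` are summable pointwise. -/
theorem summable_sandwich_diag
    (hGd : ∀ γ γ' a a', Summable fun m₀ : Fin (d + 1) → ℤ => 𝒢 (translate Tc γ m₀) (translate Tc γ' m₀) a a')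
    (β β' : Fin (d + 1) → ℤ) (b b' : B) :
    Summable fun m₀ : Fin (d + 1) → ℤ => 𝒦 (translate Tf β m₀) (translate Tf β' m₀) b b' := by
  simp_rw [sandwich_translate_diag Tc Tf CL hCL S hS 𝒢 h𝒦]
  exact summable_sum fun a _ => summable_sum fun a' _ => summable_sum fun γ _ => summable_sum fun γ' _ =>
    ((hGd γ γ' a a').mul_left _).mul_right _

/-- [folklore] **`dper_sandwich_apply` — THE DIAGONAL PERIODISATION OF THE SANDWICH IS THE SANDWICH OF THE DIAGONALLY PERIODISED CORE**
(the engine's first step, named): `dper Tf 𝒦 β β′ b b′ = Σ_{a a′} Σ_{γ ∈ S β} Σ_{γ′ ∈ S β′} CL γ a β b · dper Tc 𝒢 γ γ′ a a′ · CL γ′ a′ β′ b′`. -/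
theorem dper_sandwich_apply
    (hGd : ∀ γ γ' a a', Summable fun m₀ : Fin (d + 1) → ℤ => 𝒢 (translate Tc γ m₀) (translate Tc γ' m₀) a a')
    (β β' : Fin (d + 1) → ℤ) (b b' : B) :
    dper Tf 𝒦 β β' b b' = ∑ a, ∑ a', ∑ γ ∈ S β, ∑ γ' ∈ S β', CL γ a β b * dper Tc 𝒢 γ γ' a a' * CL γ' a' β' b' := by
  rw [dper_apply]
  simp_rw [sandwich_translate_diag Tc Tf CL hCL S hS 𝒢 h𝒦]
  have hsum : ∀ a a', Summable fun m₀ : Fin (d + 1) → ℤ => ∑ γ ∈ S β, ∑ γ' ∈ S β',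
      CL γ a β b * 𝒢 (translate Tc γ m₀) (translate Tc γ' m₀) a a' * CL γ' a' β' b' :=
    fun a a' => summable_sum fun γ _ => summable_sum fun γ' _ => ((hGd γ γ' a a').mul_left _).mul_right _
  rw [Summable.tsum_finsetSum fun a _ => summable_sum fun a' _ => hsum a a']
  refine Finset.sum_congr rfl fun a _ => ?_
  rw [Summable.tsum_finsetSum fun a' _ => hsum a a']
  refine Finset.sum_congr rfl fun a' _ => ?_
  rw [tsum_window_sandwich_of_summable (S β) (S β') (fun γ => CL γ a β b) (fun γ' => CL γ' a' β' b')
    (fun γ γ' m₀ => 𝒢 (translate Tc γ m₀) (translate Tc γ' m₀) a a') (fun γ γ' => hGd γ γ' a a')]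
  rfl

/-- [folklore] the diagonally periodised sandwich along a `Tf`-translate of its second argument = the sandwich of `dper Tc 𝒢` translated in its second argument. -/
theorem dper_sandwich_translate_right
    (hGd : ∀ γ γ' a a', Summable fun m₀ : Fin (d + 1) → ℤ => 𝒢 (translate Tc γ m₀) (translate Tc γ' m₀) a a')
    (m β β' : Fin (d + 1) → ℤ) (b b' : B) :
    dper Tf 𝒦 β (translate Tf β' m) b b'
      = ∑ a, ∑ a', ∑ γ ∈ S β, ∑ γ' ∈ S β', CL γ a β b * dper Tc 𝒢 γ (translate Tc γ' m) a a' * CL γ' a' β' b' := by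
  rw [dper_sandwich_apply Tc Tf CL hCL S hS 𝒢 h𝒦 hGd]
  exact Finset.sum_congr rfl fun a _ => Finset.sum_congr rfl fun a' _ =>
    sum_window_right_translate Tc Tf (fun γ => CL γ a β b) (S β) (fun γ β => CL γ a' β b') (fun m γ β => hCL m γ a' β b') S
      (fun γ β h => hS γ a' β b' h) (fun γ γ' => dper Tc 𝒢 γ γ' a a') m β'

/-- [folklore] **`summable_dper_sandwich_right` — THE `hSp` LETTER OF THE SANDWICH FROM THE CORE's `hGd ∕ hGp`**: the `Tf`-translates of `dper Tf 𝒦` in its second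
argument are summable pointwise. -/
theorem summable_dper_sandwich_right
    (hGd : ∀ γ γ' a a', Summable fun m₀ : Fin (d + 1) → ℤ => 𝒢 (translate Tc γ m₀) (translate Tc γ' m₀) a a')
    (hGp : ∀ γ γ' a a', Summable fun m : Fin (d + 1) → ℤ => dper Tc 𝒢 γ (translate Tc γ' m) a a')
    (β β' : Fin (d + 1) → ℤ) (b b' : B) :
    Summable fun m : Fin (d + 1) → ℤ => dper Tf 𝒦 β (translate Tf β' m) b b' := by
  simp_rw [dper_sandwich_translate_right Tc Tf CL hCL S hS 𝒢 h𝒦 hGd]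
  exact summable_sum fun a _ => summable_sum fun a' _ => summable_sum fun γ _ => summable_sum fun γ' _ =>
    ((hGp γ γ' a a').mul_left _).mul_right _

end Window

/-! ## §2 The window-free display (finitely supported `tsum`s) -/

section WindowFree

variable (CL : (Fin (d + 1) → ℤ) → A → (Fin (d + 1) → ℤ) → B → ℝ)
  (hCL : ∀ m γ a β b, CL (translate Tc γ m) a (translate Tf β m) b = CL γ a β b)
  (S : (Fin (d + 1) → ℤ) → Finset (Fin (d + 1) → ℤ)) (hS : ∀ γ a β b, γ ∉ S β → CL γ a β b = 0)
  (𝒢 : MKer (d + 1) A) {𝒦 : MKer (d + 1) B}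
  (h𝒦 : ∀ β β' b b', 𝒦 β β' b b' = ∑ a, ∑ a', ∑' γ : Fin (d + 1) → ℤ, ∑' γ' : Fin (d + 1) → ℤ, CL γ a β b * 𝒢 γ γ' a a' * CL γ' a' β' b')
include hCL hS h𝒦

omit hCL in
/-- [folklore] the window-free display is the window display (`tsum_eq_sum` twice on the leg's windows). -/
theorem sandwich_tsum_eq_window (β β' : Fin (d + 1) → ℤ) (b b' : B) :
    𝒦 β β' b b' = ∑ a, ∑ a', ∑ γ ∈ S β, ∑ γ' ∈ S β', CL γ a β b * 𝒢 γ γ' a a' * CL γ' a' β' b' := by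
  rw [h𝒦]
  refine Finset.sum_congr rfl fun a _ => Finset.sum_congr rfl fun a' _ => ?_
  have hin : ∀ γ : Fin (d + 1) → ℤ, ∑' γ' : Fin (d + 1) → ℤ, CL γ a β b * 𝒢 γ γ' a a' * CL γ' a' β' b'
      = ∑ γ' ∈ S β', CL γ a β b * 𝒢 γ γ' a a' * CL γ' a' β' b' :=
    fun γ => tsum_eq_sum fun γ' hγ' => by rw [hS γ' a' β' b' hγ', mul_zero]
  simp_rw [hin]
  exact tsum_eq_sum fun γ hγ => Finset.sum_eq_zero fun γ' _ => by rw [hS γ a β b hγ, zero_mul, zero_mul]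

/-- [folklore] `summable_sandwich_diag` for the window-free display. -/
theorem summable_sandwich_diag_of_tsum
    (hGd : ∀ γ γ' a a', Summable fun m₀ : Fin (d + 1) → ℤ => 𝒢 (translate Tc γ m₀) (translate Tc γ' m₀) a a')
    (β β' : Fin (d + 1) → ℤ) (b b' : B) :
    Summable fun m₀ : Fin (d + 1) → ℤ => 𝒦 (translate Tf β m₀) (translate Tf β' m₀) b b' :=
  summable_sandwich_diag Tc Tf CL hCL S hS 𝒢 (sandwich_tsum_eq_window CL S hS 𝒢 h𝒦) hGd β β' b b'

/-- [folklore] `summable_dper_sandwich_right` for the window-free display. -/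
theorem summable_dper_sandwich_right_of_tsum
    (hGd : ∀ γ γ' a a', Summable fun m₀ : Fin (d + 1) → ℤ => 𝒢 (translate Tc γ m₀) (translate Tc γ' m₀) a a')
    (hGp : ∀ γ γ' a a', Summable fun m : Fin (d + 1) → ℤ => dper Tc 𝒢 γ (translate Tc γ' m) a a')
    (β β' : Fin (d + 1) → ℤ) (b b' : B) :
    Summable fun m : Fin (d + 1) → ℤ => dper Tf 𝒦 β (translate Tf β' m) b b' :=
  summable_dper_sandwich_right Tc Tf CL hCL S hS 𝒢 (sandwich_tsum_eq_window CL S hS 𝒢 h𝒦) hGd hGp β β' b b'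

end WindowFree

end Summit.QuantumFields.BalabanUV.Beta.FP.TorusTwoScaleSandwichLetters

end
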